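import Summits.Ventures.CertifiedManyBodySolver.Rows.DopedTLCorr
import Literature.MathematicalPhysics.QuantumLattice.InfVolFermionStateBounds
import HarnessLib

/-!
# Diagonal dominance of the pair two-point function and DERIVED thermodynamic-limit pair rows

HONEST FRAMING: first certified bounds; not a superconductivity verdict; every number certified or
labelled float.  Speedrun `mbsolver`, seat sr-mbsolver-m3-2 (pairing layer), gen 12, item (C).
Theorem-only; no definition, no named fact; zero compute.  Nothing here is specific to the Hubbard
model except the row grammar of §2 (whose Hamiltonian hypotheses are used only through translation
invariance of torus-limit states).

The point.  `Observables/LocalPairCeilingTL.lean` boxed every pair two-point value of every state in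
the KINEMATIC interval `[-Σ g², Σ g²]` (`d`-wave: `[-4, 4]`).  Here the box is made STATE-DEPENDENT and
LOCAL: for every state `ω` and all sites `x, y`
  `|Re ω(P_x† P_y)| ≤ (ω(P_x† P_x) + ω(P_y† P_y)) / 2`                      (`abs_re_pairCorr_le_half_add`)
(positivity of `ω` on `(Γ P_x ∓ Γ P_y)†(Γ P_x ∓ Γ P_y)` in the local algebra of
`pairRegion S x ∪ pairRegion S y`, and Hermiticity), hence for a TRANSLATION-INVARIANT state
  `|Re ω(P_x† P_y)| ≤ p(0) := Re ω(P_0† P_0)` for ALL `x, y`       (`…abs_re_pairCorr_le_self`)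
and `|Σ_{x∈B} Σ_{y∈C} Re ω(P_x† P_y)| ≤ |B|·|C|·p(0)` (`…abs_sum_sum_re_pairCorr_le`: every box
average of the pair two-point function — the off-diagonal-long-range-order functional — is `≤ p(0)`).

Row grammar (§2, `Rows/DopedTLCorr.lean`; torus-limit row states are translation invariant,
`IsTorusLimitOf.isTranslationInvariant`): ONE certified UPPER row for the LOCAL pair density at the
origin, `SquareTTPrimeCorrUpperRow t′ U n u pu _ (Γ(P_0)† Γ(P_0))` (an extent-2, degree-4 local
observable on the 5-site cross), yields at the same `(t′, U, n, u)` and for EVERY pair of sites the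
DERIVED cells `SquareTTPrimeCorrUpperRow … pu _ (Γ(P_x)† Γ(P_y))` and
`SquareTTPrimeCorrLowerRow … (-pu) _ (Γ(P_x)† Γ(P_y))` (`squareTTPrime_pair_upperRow_of_self`,
`squareTTPrime_pair_lowerRow_of_self`), and the diagonal rows transfer from the origin to every site
(`…_self_upperRow_of_origin`, `…_self_lowerRow_of_origin`); M3′ `d`-wave names
`m3_dWavePair_upperRow_of_self`, `m3_dWavePair_lowerRow_of_self`, `m3_dWavePair_self_upperRow_of_origin`.
Combined with the kinematic cells of `LocalPairCeilingTL` the a-priori box of a TL `d`-wave pair row is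
`[max(-4, -pu), min(4, pu)]`.  No certified `pu` exists in the tree today; the theorems are the
consumer for one.

References: O. Bratteli, D. W. Robinson, Operator Algebras and Quantum Statistical Mechanics I, 2nd
ed., §2.3.2–2.3.3 (states: positivity, Cauchy–Schwarz), §4.3.1 (invariant states); G. L. Sewell,
J. Math. Phys. 11 (1970) 1868, §4 (ODLRO of a state of the quasi-local algebra); D. J. Scalapino,
Phys. Rep. 250 (1995) 329, §2 eq. (2.4).  Folklore otherwise.
-/

noncomputable section

namespace Summit.Ventures.CertifiedManyBodySolver.Observables
open Matrix Literature.MathematicalPhysics.QuantumLattice Literature.Probability.LatticeModels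
open scoped ComplexOrder ComplexConjugate BigOperators

namespace SingletPair

/-! ## §1 Every state: the cross term is dominated by the diagonal -/

section State

variable {d : ℕ} (ω : InfVolFermionState d)

/-- **`|Re ω(A† B)| ≤ (Re ω(A† A) + Re ω(B† B)) / 2`** for local observables `A ∈ 𝔄_{Λ₁}`,
`B ∈ 𝔄_{Λ₂}` of the lattice fermions and every state `ω` (the two-point functions `ω.corr`
computed by isotony in `𝔄_{Λ₁ ∪ Λ₂}`): positivity of `ω` on `(ΓA ∓ ΓB)†(ΓA ∓ ΓB)` and Hermiticity
`Re ω((ΓB)† ΓA) = Re ω((ΓA)† ΓB)`. Bratteli–Robinson I §2.3.2–2.3.3.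
[cite: BratteliRobinsonI1987, §2.3.3 (Thm. 2.3.16)] -/
theorem abs_re_corr_le_half_add {Λ₁ Λ₂ : Finset (Site d)} (A : FermionOp Λ₁) (B : FermionOp Λ₂) :
    |(ω.corr Aᴴ B).re| ≤ ((ω.corr Aᴴ A).re + (ω.corr Bᴴ B).re) / 2 := by
  have hAB : ω.corr Aᴴ B = ω.expect (Λ₁ ∪ Λ₂)
      ((fermionEmbed (PolySite.incl Finset.subset_union_left) A)ᴴ *
        fermionEmbed (PolySite.incl Finset.subset_union_right) B) := by
    rw [InfVolFermionState.corr_eq, fermionEmbed_conjTranspose]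
  have hAA : ω.corr Aᴴ A = ω.expect (Λ₁ ∪ Λ₂)
      ((fermionEmbed (PolySite.incl Finset.subset_union_left) A)ᴴ *
        fermionEmbed (PolySite.incl Finset.subset_union_left) A) := by
    rw [ω.corr_eq_expect_of_subset (Finset.subset_union_left : Λ₁ ⊆ Λ₁ ∪ Λ₂)
      (Finset.subset_union_left : Λ₁ ⊆ Λ₁ ∪ Λ₂), fermionEmbed_conjTranspose]
  have hBB : ω.corr Bᴴ B = ω.expect (Λ₁ ∪ Λ₂)
      ((fermionEmbed (PolySite.incl Finset.subset_union_right) B)ᴴ *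
        fermionEmbed (PolySite.incl Finset.subset_union_right) B) := by
    rw [ω.corr_eq_expect_of_subset (Finset.subset_union_right : Λ₂ ⊆ Λ₁ ∪ Λ₂)
      (Finset.subset_union_right : Λ₂ ⊆ Λ₁ ∪ Λ₂), fermionEmbed_conjTranspose]
  set A' : FermionOp (Λ₁ ∪ Λ₂) := fermionEmbed (PolySite.incl Finset.subset_union_left) A with hA'
  set B' : FermionOp (Λ₁ ∪ Λ₂) := fermionEmbed (PolySite.incl Finset.subset_union_right) B with hB'
  have hre : (ω.expect (Λ₁ ∪ Λ₂) (B'ᴴ * A')).re = (ω.expect (Λ₁ ∪ Λ₂) (A'ᴴ * B')).re := by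
    rw [show B'ᴴ * A' = (A'ᴴ * B')ᴴ by
        rw [Matrix.conjTranspose_mul, Matrix.conjTranspose_conjTranspose],
      ω.expect_conjTranspose, Complex.star_def, Complex.conj_re]
  have h1 := ω.expect_re_nonneg_of_posSemidef (Λ₁ ∪ Λ₂)
    (Matrix.posSemidef_conjTranspose_mul_self (A' - B'))
  have h2 := ω.expect_re_nonneg_of_posSemidef (Λ₁ ∪ Λ₂)
    (Matrix.posSemidef_conjTranspose_mul_self (A' + B'))
  rw [Matrix.conjTranspose_sub, Matrix.sub_mul, Matrix.mul_sub, Matrix.mul_sub, map_sub, map_sub,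
    map_sub, Complex.sub_re, Complex.sub_re, Complex.sub_re] at h1
  rw [Matrix.conjTranspose_add, Matrix.add_mul, Matrix.mul_add, Matrix.mul_add, map_add, map_add,
    map_add, Complex.add_re, Complex.add_re, Complex.add_re] at h2
  rw [hAB, hAA, hBB, abs_le]
  constructor <;> linarith

variable (S : Finset (Site 2)) (g : Site 2 → ℝ)

/-- **Diagonal dominance of the pair two-point function of every state**:
`|Re ω(P_x† P_y)| ≤ (Re ω(P_x† P_x) + Re ω(P_y† P_y)) / 2` for all `x, y`, every step set `S` and
every form factor `g`. Bratteli–Robinson I §2.3.3; Scalapino, Phys. Rep. 250 (1995) 329, §2 eq. (2.4).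
[cite: BratteliRobinsonI1987, §2.3.3 (Thm. 2.3.16)] -/
theorem abs_re_pairCorr_le_half_add (ω : InfVolFermionState 2) (x y : Site 2) :
    |(ω.pairCorr S g x y).re| ≤ ((ω.pairCorr S g x x).re + (ω.pairCorr S g y y).re) / 2 :=
  abs_re_corr_le_half_add ω (localPairAt S g x) (localPairAt S g y)

/-- For a translation-invariant state the local pair density `Re ω(P_x† P_x)` does not depend on
the site. [cite: Sewell1970, §4] -/
theorem re_pairCorr_self_eq_origin {ω : InfVolFermionState 2} (hω : ω.IsTranslationInvariant)
    (x : Site 2) : (ω.pairCorr S g x x).re = (ω.pairCorr S g 0 0).re := by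
  have h := hω.pairCorr_add S g 0 0 x
  rw [zero_add] at h
  rw [h]

/-- **Translation-invariant states: `|Re ω(P_x† P_y)| ≤ p(0) := Re ω(P_0† P_0)` for ALL `x, y`**
— the whole pair correlation function is boxed by the local pair density at one site.
Bratteli–Robinson I §2.3.3 and §4.3.1; Sewell 1970 §4. [cite: BratteliRobinsonI1987, §2.3.3 (Thm. 2.3.16)] -/
theorem abs_re_pairCorr_le_self {ω : InfVolFermionState 2} (hω : ω.IsTranslationInvariant)
    (x y : Site 2) : |(ω.pairCorr S g x y).re| ≤ (ω.pairCorr S g 0 0).re := by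
  have h := abs_re_pairCorr_le_half_add S g ω x y
  rw [re_pairCorr_self_eq_origin S g hω x, re_pairCorr_self_eq_origin S g hω y] at h
  linarith

/-- **The ODLRO functional is capped by the local pair density**: for a translation-invariant state
and finite site sets `B, C`, `|Σ_{x∈B} Σ_{y∈C} Re ω(P_x† P_y)| ≤ |B|·|C|·p(0)`; in particular every
box average `|B|⁻² Σ_{x,y∈B} Re ω(P_x† P_y)` (whose large-box behaviour is off-diagonal long-range
order, Sewell 1970 §4) is `≤ p(0)`. [cite: Sewell1970, §4 (Thm. 4.3)] -/
theorem abs_sum_sum_re_pairCorr_le {ω : InfVolFermionState 2} (hω : ω.IsTranslationInvariant)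
    (B C : Finset (Site 2)) :
    |∑ x ∈ B, ∑ y ∈ C, (ω.pairCorr S g x y).re| ≤ B.card * C.card * (ω.pairCorr S g 0 0).re := by
  refine (Finset.abs_sum_le_sum_abs _ _).trans ?_
  calc ∑ x ∈ B, |∑ y ∈ C, (ω.pairCorr S g x y).re|
      ≤ ∑ x ∈ B, ∑ y ∈ C, |(ω.pairCorr S g x y).re| :=
        Finset.sum_le_sum fun x _ => Finset.abs_sum_le_sum_abs _ _
    _ ≤ ∑ _x ∈ B, ∑ _y ∈ C, (ω.pairCorr S g 0 0).re :=
        Finset.sum_le_sum fun x _ => Finset.sum_le_sum fun y _ => abs_re_pairCorr_le_self S g hω x y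
    _ = B.card * C.card * (ω.pairCorr S g 0 0).re := by
        rw [Finset.sum_const, Finset.sum_const, smul_smul, nsmul_eq_mul]; push_cast; ring

/-- `d`-wave, translation-invariant states: `|Re ω.dWavePairCorr x y| ≤ Re ω.dWavePairCorr 0 0`.
[cite: BratteliRobinsonI1987, §2.3.3 (Thm. 2.3.16)] -/
theorem abs_re_dWavePairCorr_le_self {ω : InfVolFermionState 2} (hω : ω.IsTranslationInvariant)
    (x y : Site 2) : |(ω.dWavePairCorr x y).re| ≤ (ω.dWavePairCorr 0 0).re :=
  abs_re_pairCorr_le_self _ _ hω x y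

end State

end SingletPair

end Summit.Ventures.CertifiedManyBodySolver.Observables

/-! ## §2 Row grammar: one local pair-density row boxes every pair row -/

namespace Summit.Ventures.CertifiedManyBodySolver

open Matrix Literature.MathematicalPhysics.QuantumLattice Literature.Probability.LatticeModels
open Literature.MathematicalPhysics.QuantumLattice.HubbardWave0
open ThermodynamicLimit Filter Topology
open scoped BigOperators ComplexOrder

/-- The pair two-point word `Γ(P_x)† Γ(P_y)` in `𝔄_{pairRegion S x ∪ pairRegion S y}` IS the word of
`InfVolFermionState.corr`: `ω.pairCorr S g x y = ω.expect _ (word)` by `rfl` (general step set and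
form factor; the `d`-wave case is `dWavePairCorr_eq_expect`). [cite: Sewell1970, §4 (Thm. 4.3)] -/
theorem pairCorr_eq_expect (ω : InfVolFermionState 2) (S : Finset (Site 2)) (g : Site 2 → ℝ)
    (x y : Site 2) :
    ω.pairCorr S g x y = ω.expect (pairRegion S x ∪ pairRegion S y)
      (fermionEmbed (PolySite.incl Finset.subset_union_left) (localPairAt S g x)ᴴ *
        fermionEmbed (PolySite.incl Finset.subset_union_right) (localPairAt S g y)) := rfl

section Rows

variable {tp U n : ℝ} {u pu pl : ℚ} {S : Finset (Site 2)} {g : Site 2 → ℝ}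

/-- **An UPPER row for the local pair density at the origin is an UPPER row for every pair
two-point word**: `SquareTTPrimeCorrUpperRow t′ U n u pu _ (Γ(P_0)† Γ(P_0))` gives
`SquareTTPrimeCorrUpperRow t′ U n u pu _ (Γ(P_x)† Γ(P_y))` for all `x, y` (torus-limit row states are
translation invariant; diagonal dominance). DERIVED cell; the constant is the hypothesis row's.
Bratteli–Robinson I §2.3.3, §4.3.1. [cite: BratteliRobinsonI1987, §2.3.3 (Thm. 2.3.16)] -/
theorem squareTTPrime_pair_upperRow_of_self
    (h : SquareTTPrimeCorrUpperRow tp U n u pu (pairRegion S 0 ∪ pairRegion S 0)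
      (fermionEmbed (PolySite.incl Finset.subset_union_left) (localPairAt S g 0)ᴴ *
        fermionEmbed (PolySite.incl Finset.subset_union_right) (localPairAt S g 0)))
    (x y : Site 2) :
    SquareTTPrimeCorrUpperRow tp U n u pu (pairRegion S x ∪ pairRegion S y)
      (fermionEmbed (PolySite.incl Finset.subset_union_left) (localPairAt S g x)ᴴ *
        fermionEmbed (PolySite.incl Finset.subset_union_right) (localPairAt S g y)) := by
  intro ω Ls ψ hLs hgs hψ1 hω hu
  have h0 := h ω Ls ψ hLs hgs hψ1 hω hu
  rw [← pairCorr_eq_expect] at h0 ⊢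
  exact (le_abs_self _).trans
    ((Observables.SingletPair.abs_re_pairCorr_le_self S g hω.isTranslationInvariant x y).trans h0)

/-- **… and a LOWER row `-pu` for every pair two-point word**:
`SquareTTPrimeCorrUpperRow t′ U n u pu _ (Γ(P_0)† Γ(P_0))` gives
`SquareTTPrimeCorrLowerRow t′ U n u (-pu) _ (Γ(P_x)† Γ(P_y))` for all `x, y`. DERIVED cell.
Bratteli–Robinson I §2.3.3, §4.3.1. [cite: BratteliRobinsonI1987, §2.3.3 (Thm. 2.3.16)] -/
theorem squareTTPrime_pair_lowerRow_of_self
    (h : SquareTTPrimeCorrUpperRow tp U n u pu (pairRegion S 0 ∪ pairRegion S 0)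
      (fermionEmbed (PolySite.incl Finset.subset_union_left) (localPairAt S g 0)ᴴ *
        fermionEmbed (PolySite.incl Finset.subset_union_right) (localPairAt S g 0)))
    (x y : Site 2) :
    SquareTTPrimeCorrLowerRow tp U n u (-pu) (pairRegion S x ∪ pairRegion S y)
      (fermionEmbed (PolySite.incl Finset.subset_union_left) (localPairAt S g x)ᴴ *
        fermionEmbed (PolySite.incl Finset.subset_union_right) (localPairAt S g y)) := by
  intro ω Ls ψ hLs hgs hψ1 hω hu
  have h0 := h ω Ls ψ hLs hgs hψ1 hω hu
  rw [← pairCorr_eq_expect] at h0 ⊢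
  have h1 := (neg_abs_le _).trans'
    (neg_le_neg ((Observables.SingletPair.abs_re_pairCorr_le_self S g hω.isTranslationInvariant x y).trans h0))
  push_cast
  exact h1

/-- The diagonal UPPER row transfers from the origin to every site (translation invariance of the
row states): `…UpperRow … pu _ (Γ(P_0)† Γ(P_0)) → …UpperRow … pu _ (Γ(P_x)† Γ(P_x))`.
Bratteli–Robinson I §4.3.1. [cite: BratteliRobinsonI1987, §4.3.1] -/
theorem squareTTPrime_pair_self_upperRow_of_origin
    (h : SquareTTPrimeCorrUpperRow tp U n u pu (pairRegion S 0 ∪ pairRegion S 0)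
      (fermionEmbed (PolySite.incl Finset.subset_union_left) (localPairAt S g 0)ᴴ *
        fermionEmbed (PolySite.incl Finset.subset_union_right) (localPairAt S g 0)))
    (x : Site 2) :
    SquareTTPrimeCorrUpperRow tp U n u pu (pairRegion S x ∪ pairRegion S x)
      (fermionEmbed (PolySite.incl Finset.subset_union_left) (localPairAt S g x)ᴴ *
        fermionEmbed (PolySite.incl Finset.subset_union_right) (localPairAt S g x)) := by
  intro ω Ls ψ hLs hgs hψ1 hω hu
  have h0 := h ω Ls ψ hLs hgs hψ1 hω hu
  rw [← pairCorr_eq_expect] at h0 ⊢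
  rwa [Observables.SingletPair.re_pairCorr_self_eq_origin S g hω.isTranslationInvariant x]

/-- The diagonal LOWER row transfers from the origin to every site:
`…LowerRow … pl _ (Γ(P_0)† Γ(P_0)) → …LowerRow … pl _ (Γ(P_x)† Γ(P_x))`.
Bratteli–Robinson I §4.3.1. [cite: BratteliRobinsonI1987, §4.3.1] -/
theorem squareTTPrime_pair_self_lowerRow_of_origin
    (h : SquareTTPrimeCorrLowerRow tp U n u pl (pairRegion S 0 ∪ pairRegion S 0)
      (fermionEmbed (PolySite.incl Finset.subset_union_left) (localPairAt S g 0)ᴴ *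
        fermionEmbed (PolySite.incl Finset.subset_union_right) (localPairAt S g 0)))
    (x : Site 2) :
    SquareTTPrimeCorrLowerRow tp U n u pl (pairRegion S x ∪ pairRegion S x)
      (fermionEmbed (PolySite.incl Finset.subset_union_left) (localPairAt S g x)ᴴ *
        fermionEmbed (PolySite.incl Finset.subset_union_right) (localPairAt S g x)) := by
  intro ω Ls ψ hLs hgs hψ1 hω hu
  have h0 := h ω Ls ψ hLs hgs hψ1 hω hu
  rw [← pairCorr_eq_expect] at h0 ⊢
  rwa [Observables.SingletPair.re_pairCorr_self_eq_origin S g hω.isTranslationInvariant x]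

end Rows

section M3

variable {tp : ℝ} {u pu pl : ℚ}

/-- **M3′ point, `d`-wave**: a (future) certified UPPER row `pu` for the local `d`-wave pair density
`Re ω(P_0† P_0)` — `M3CorrUpperRow t′ u pu _ (Γ(P_0)† Γ(P_0))` — boxes EVERY `d`-wave pair row from
above: `M3CorrUpperRow t′ u pu _ (Γ(P_x)† Γ(P_y))`. DERIVED cell; informative iff `pu < 4`
(`m3_dWavePair_upperRow`). [cite: BratteliRobinsonI1987, §2.3.3 (Thm. 2.3.16)] -/
theorem m3_dWavePair_upperRow_of_self
    (h : M3CorrUpperRow tp u pu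
      (pairRegion (insert 0 unitSteps) 0 ∪ pairRegion (insert 0 unitSteps) 0)
      (fermionEmbed (PolySite.incl Finset.subset_union_left)
          (localPairAt (insert 0 unitSteps) dWaveFormFactor 0)ᴴ *
        fermionEmbed (PolySite.incl Finset.subset_union_right)
          (localPairAt (insert 0 unitSteps) dWaveFormFactor 0)))
    (x y : Site 2) :
    M3CorrUpperRow tp u pu
      (pairRegion (insert 0 unitSteps) x ∪ pairRegion (insert 0 unitSteps) y)
      (fermionEmbed (PolySite.incl Finset.subset_union_left)
          (localPairAt (insert 0 unitSteps) dWaveFormFactor x)ᴴ *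
        fermionEmbed (PolySite.incl Finset.subset_union_right)
          (localPairAt (insert 0 unitSteps) dWaveFormFactor y)) :=
  squareTTPrime_pair_upperRow_of_self h x y

/-- **M3′ point, `d`-wave**: the same local pair-density UPPER row boxes every `d`-wave pair row from
BELOW: `M3CorrLowerRow t′ u (-pu) _ (Γ(P_x)† Γ(P_y))`. DERIVED cell; informative iff `pu < 4`
(`m3_dWavePair_lowerRow`). [cite: BratteliRobinsonI1987, §2.3.3 (Thm. 2.3.16)] -/
theorem m3_dWavePair_lowerRow_of_self
    (h : M3CorrUpperRow tp u pu
      (pairRegion (insert 0 unitSteps) 0 ∪ pairRegion (insert 0 unitSteps) 0)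
      (fermionEmbed (PolySite.incl Finset.subset_union_left)
          (localPairAt (insert 0 unitSteps) dWaveFormFactor 0)ᴴ *
        fermionEmbed (PolySite.incl Finset.subset_union_right)
          (localPairAt (insert 0 unitSteps) dWaveFormFactor 0)))
    (x y : Site 2) :
    M3CorrLowerRow tp u (-pu)
      (pairRegion (insert 0 unitSteps) x ∪ pairRegion (insert 0 unitSteps) y)
      (fermionEmbed (PolySite.incl Finset.subset_union_left)
          (localPairAt (insert 0 unitSteps) dWaveFormFactor x)ᴴ *
        fermionEmbed (PolySite.incl Finset.subset_union_right)
          (localPairAt (insert 0 unitSteps) dWaveFormFactor y)) :=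
  squareTTPrime_pair_lowerRow_of_self h x y

/-- M3′ point, `d`-wave: the local pair-density UPPER row at the origin holds at every site.
[cite: BratteliRobinsonI1987, §4.3.1] -/
theorem m3_dWavePair_self_upperRow_of_origin
    (h : M3CorrUpperRow tp u pu
      (pairRegion (insert 0 unitSteps) 0 ∪ pairRegion (insert 0 unitSteps) 0)
      (fermionEmbed (PolySite.incl Finset.subset_union_left)
          (localPairAt (insert 0 unitSteps) dWaveFormFactor 0)ᴴ *
        fermionEmbed (PolySite.incl Finset.subset_union_right)
          (localPairAt (insert 0 unitSteps) dWaveFormFactor 0)))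
    (x : Site 2) :
    M3CorrUpperRow tp u pu
      (pairRegion (insert 0 unitSteps) x ∪ pairRegion (insert 0 unitSteps) x)
      (fermionEmbed (PolySite.incl Finset.subset_union_left)
          (localPairAt (insert 0 unitSteps) dWaveFormFactor x)ᴴ *
        fermionEmbed (PolySite.incl Finset.subset_union_right)
          (localPairAt (insert 0 unitSteps) dWaveFormFactor x)) :=
  squareTTPrime_pair_self_upperRow_of_origin h x

/-- M3′ point, `d`-wave: a local pair-density LOWER row at the origin holds at every site.
[cite: BratteliRobinsonI1987, §4.3.1] -/
theorem m3_dWavePair_self_lowerRow_of_origin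
    (h : M3CorrLowerRow tp u pl
      (pairRegion (insert 0 unitSteps) 0 ∪ pairRegion (insert 0 unitSteps) 0)
      (fermionEmbed (PolySite.incl Finset.subset_union_left)
          (localPairAt (insert 0 unitSteps) dWaveFormFactor 0)ᴴ *
        fermionEmbed (PolySite.incl Finset.subset_union_right)
          (localPairAt (insert 0 unitSteps) dWaveFormFactor 0)))
    (x : Site 2) :
    M3CorrLowerRow tp u pl
      (pairRegion (insert 0 unitSteps) x ∪ pairRegion (insert 0 unitSteps) x)
      (fermionEmbed (PolySite.incl Finset.subset_union_left)
          (localPairAt (insert 0 unitSteps) dWaveFormFactor x)ᴴ *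
        fermionEmbed (PolySite.incl Finset.subset_union_right)
          (localPairAt (insert 0 unitSteps) dWaveFormFactor x)) :=
  squareTTPrime_pair_self_lowerRow_of_origin h x

end M3

end Summit.Ventures.CertifiedManyBodySolver

end
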